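import Mathlib
import HarnessLib

/-!
# The multiset of Frobenius eigenvalues is determined by the numbers `∏ᵢ (1 - aᵢʳ)`
# (the counting lemma in Weil's determination of the characteristic polynomial of Frobenius)

Topic `NumberTheory/LFunctions` (zeta functions of curves and abelian varieties over finite fields);
**proof file**, theorems and two auxiliary counting functions only (D-0014, D-0026: no named facts).

**The lemma.** Let `a₁, …, a_m` be nonzero complex numbers and `b₁, …, b_n` complex numbers all of
the same modulus `c > 1`. If
`∏ᵢ (1 - aᵢʳ) = ∏ⱼ (1 - bⱼʳ)` for every integer `r ≥ 1`,
then `m = n` and `{aᵢ} = {bⱼ}` as multisets (`cnt_eq_cnt`, `univ_val_map_eq`, `card_eq_card`,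
`prod_one_sub_C_mul_X_eq`, `norm_eq`).

**Where it is used.** For an abelian variety (or the Jacobian of a curve) over `𝔽_q` one knows
`#A(𝔽_{q^r}) = deg(1 - π^r) = det(1 - π^r | T_ℓ A) = ∏ᵢ (1 - aᵢʳ)` with `aᵢ` the eigenvalues of the
Frobenius `π` on `V_ℓ A` (Milne, *Abelian varieties*, Thm. 19.1 and its proof; Lang, *Abelian
Varieties*, VII §1 Thm. 3, V §3), while for the Jacobian `J` of a curve with function field `F`,
`#J(𝔽_{q^r}) = h(F𝔽_{q^r}) = L_r(1) = ∏ᵢ (1 - αᵢʳ)` with `αᵢ` the reciprocal roots of the `L`-polynomial,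
`|αᵢ| = √q` (Stichtenoth Thm. 5.1.15 (c), (f), Thm. 5.2.1). The lemma then gives
`{aᵢ} = {αᵢ}`: the characteristic polynomial of Frobenius on `T_ℓ J` is the reciprocal
`L`-polynomial, whence `#C(𝔽_q) = q + 1 - Tr(π | T_ℓ J)` (Milne, *Jacobian varieties*, Thm. 11.1).
Lang proves the analogous statement `ℓ`-adically (VII §1, Lemma before Thm. 3, from
`‖∏ F(ωᵢ)‖_ℓ = ‖∏ F(ηᵢ)‖_ℓ` for all `F ∈ ℤ[X]`); the present archimedean form needs only the values
`F = 1 - Xʳ` together with the Riemann hypothesis `|αᵢ| = √q > 1`, which is what the function-field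
side supplies. In this tree it serves the elementary half of the proof of the trace formula for the
curves `y^p = f(x)` (`Literature.NumberTheory.GaloisRepresentations.picardCurve_exists_lambdaAdicRep`).

**Proof** (elementary; all steps below are proved here). Expanding, `∏ᵢ (1 - aᵢʳ) = ∑_S (-1)^{|S|} a_Sʳ`
with `a_S = ∏_{i ∈ S} aᵢ` (`prod_one_sub_pow_eq_sum`), so the hypothesis says that the signed counting
functions `μ_a(z) = ∑_{S : a_S = z} (-1)^{|S|}` and `μ_b` have the same moments `∑_z μ(z) zʳ`, `r ≥ 1`;
by Lagrange interpolation (`eq_zero_of_forall_sum_mul_pow_eq_zero`) `μ_a = μ_b`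
(`sgnCount_eq_sgnCount`; all `a_S, b_T ≠ 0`). Moduli: if some `|aᵢ| = 1` the involution
`S ↦ S ∆ {i}` shows that the push-forward `M_a(t) = ∑_{|a_S| = t} (-1)^{|S|}` vanishes identically,
whereas `M_b(1) = 1` (only `T = ∅`), contradiction; if some `|aᵢ| < 1`, the set `S₀` of all such
indices gives the unique subset product of least modulus `< 1`, where `μ_a = ±1 ≠ 0 = μ_b`. Hence all
`|aᵢ| > 1` (`one_lt_norm`). If `t > 1` bounds all `|aᵢ|` from below then on the circle `|z| = t` only
singletons contribute: `μ_a(z) = -#{i : aᵢ = z}` (`sgnCount_eq_neg_cnt`). Comparing `μ_a = μ_b` at an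
`aᵢ` of least modulus `ρ` and at a `bⱼ` gives `ρ = c`, so the counts agree on the circle `|z| = c`
(`cnt_eq_cnt_of_norm_eq`); cancelling this common (nonvanishing) part of the products, the remaining
`aᵢ` (of modulus `≠ c`) satisfy `∏ (1 - aᵢʳ) = 1` for all `r`, and a nonempty such family would force
the empty family to be nonempty (`nonempty_of_nonempty`), so there are none (`cnt_eq_cnt`).

## Contents

* `FrobeniusMultiset.subProd`, `sgnCount`, `cnt`, `normCount` — `a_S`, `μ_a`, `#_a`, `M_a`;
* `prod_one_sub_pow_eq_sum`, `sum_sgnCount_mul_pow`, `eq_zero_of_forall_sum_mul_pow_eq_zero`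
  (geometric progressions `r ↦ zʳ`, `z ≠ 0` distinct, are linearly independent),
  `sgnCount_eq_sgnCount`;
* `normCount_eq_zero_of_norm_eq_one`, `normCount_one`, `one_lt_norm`;
* `sgnCount_eq_neg_cnt`, `nonempty_of_nonempty`, `cnt_eq_cnt_of_norm_eq`;
* **`cnt_eq_cnt`**, **`univ_val_map_eq`**, `card_eq_card`, **`prod_one_sub_C_mul_X_eq`**, `norm_eq`.

## References

* J. S. Milne, *Abelian Varieties*, in: Cornell–Silverman, *Arithmetic Geometry* (1986), Ch. V,
  Thm. 19.1 (and its proof: `N_m = deg(π^m - 1) = ∏ (1 - aᵢ^m)`), Cor. 19.4 (held copy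
  `book:cornellnd-arithmetic-geometry`, PDF pp. 212–214). [Milne1986AbelianVarieties]
* J. S. Milne, *Jacobian Varieties*, ibid. Ch. VII, §11, Thm. 11.1 (PDF p. 272).
  [Milne1986JacobianVarieties]
* S. Lang, *Abelian Varieties*, Springer 1983 (reprint of 1959), VII §1, Lemma and Thm. 3 (held copy
  `book:langnd-abelian-varieties`, text pp. 137–138). [Lang1983AbelianVarieties]
* H. Stichtenoth, *Algebraic Function Fields and Codes*, 2nd ed. (2009), Thm. 5.1.15, Thm. 5.2.1.
  [Stichtenoth2009]

## Design notes

* Families are indexed by arbitrary `Fintype`s `ι`, `κ` (so that sub-families are subtypes); the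
  conclusion is offered as equality of counting functions, of the multisets `univ.val.map a`, of
  cardinalities, of the polynomials `∏ (1 - aᵢ t)`, and as `|aᵢ| = c`.
* `open scoped Classical` (counting functions filter on equality in `ℂ`).
* Mathlib searched/used: `Finset.prod_add`, `Finset.prod_comp`, `Finset.prod_subtype`,
  `Finset.prod_filter_mul_prod_filter_not`, `Finset.sum_involution`, `Finset.prod_inter_mul_prod_sdiff`,
  `Polynomial.eval_eq_sum_range'`, `Multiset.count_map`, `lt_self_pow₀`, `le_self_pow₀`. Mathlib has
  Newton's identities (`MvPolynomial.psum`) but no statement recovering a multiset from the values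
  `∏ (1 - aᵢʳ)` (searched `prod_one_sub`, `Multiset` ∧ `pow` ∧ `eq_of_forall`).
-/

noncomputable section

open Finset Polynomial
open scoped Classical

namespace Literature.NumberTheory.LFunctions

namespace FrobeniusMultiset

variable {ι : Type*} [Fintype ι]

/-- The subset product `a_S = ∏_{i ∈ S} aᵢ`. [folklore] -/
def subProd (a : ι → ℂ) (S : Finset ι) : ℂ := ∏ i ∈ S, a i

omit [Fintype ι] in
/-- `a_∅ = 1`. [folklore] -/
@[simp] theorem subProd_empty (a : ι → ℂ) : subProd a ∅ = 1 := by simp [subProd]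

omit [Fintype ι] in
/-- `a_{{i}} = aᵢ`. [folklore] -/
@[simp] theorem subProd_singleton (a : ι → ℂ) (i : ι) : subProd a {i} = a i := by simp [subProd]

omit [Fintype ι] in
/-- `‖a_S‖ = ∏_{i ∈ S} ‖aᵢ‖`. [folklore] -/
theorem norm_subProd (a : ι → ℂ) (S : Finset ι) : ‖subProd a S‖ = ∏ i ∈ S, ‖a i‖ := by
  simp [subProd]

omit [Fintype ι] in
/-- `a_S ≠ 0` when all `aᵢ ≠ 0`. [folklore] -/
theorem subProd_ne_zero {a : ι → ℂ} (ha : ∀ i, a i ≠ 0) (S : Finset ι) : subProd a S ≠ 0 :=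
  Finset.prod_ne_zero_iff.2 fun i _ => ha i

/-- The signed count `μ_a(z) = ∑_{S : a_S = z} (-1)^{|S|}`. [folklore] -/
def sgnCount (a : ι → ℂ) (z : ℂ) : ℤ :=
  ∑ S : Finset ι, if subProd a S = z then (-1) ^ S.card else 0

/-- The plain count `#{i : aᵢ = z}`. [folklore] -/
def cnt (a : ι → ℂ) (z : ℂ) : ℕ := (univ.filter fun i => a i = z).card

/-- `∏ᵢ (1 - aᵢʳ) = ∑_S (-1)^{|S|} a_Sʳ` (expanding the product). [folklore] -/
theorem prod_one_sub_pow_eq_sum (a : ι → ℂ) (r : ℕ) :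
    ∏ i, (1 - a i ^ r) = ∑ S : Finset ι, (-1 : ℂ) ^ S.card * subProd a S ^ r := by
  have h : ∏ i, (1 - a i ^ r) = ∏ i ∈ (univ : Finset ι), (-(a i ^ r) + 1) :=
    Finset.prod_congr rfl fun i _ => by ring
  rw [h, Finset.prod_add]
  simp only [Finset.prod_const_one, mul_one, Finset.powerset_univ]
  refine Finset.sum_congr rfl fun S _ => ?_
  rw [subProd, ← Finset.prod_pow, ← Finset.prod_const (-1 : ℂ), ← Finset.prod_mul_distrib]
  exact Finset.prod_congr rfl fun i _ => by ring

/-- Regrouping `∑_S (-1)^{|S|} a_Sʳ` by the value `z = a_S`: it is `∑_{z ∈ V} μ_a(z) zʳ` for any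
finite set `V` containing all the `a_S`. [folklore] -/
theorem sum_sgnCount_mul_pow (a : ι → ℂ) {V : Finset ℂ} (hV : ∀ S, subProd a S ∈ V) (r : ℕ) :
    ∑ z ∈ V, (sgnCount a z : ℂ) * z ^ r = ∑ S : Finset ι, (-1 : ℂ) ^ S.card * subProd a S ^ r := by
  simp only [sgnCount, Int.cast_sum, Int.cast_ite, Int.cast_pow, Int.cast_neg, Int.cast_one,
    Int.cast_zero, Finset.sum_mul]
  rw [Finset.sum_comm]
  refine Finset.sum_congr rfl fun S _ => ?_
  rw [Finset.sum_eq_single (subProd a S)]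
  · simp
  · intro z _ hz
    rw [if_neg (Ne.symm hz), zero_mul]
  · intro h
    exact absurd (hV S) h

/-- `μ_a` vanishes off the values `a_S`. [folklore] -/
theorem sgnCount_eq_zero_of_forall_ne {a : ι → ℂ} {z : ℂ} (h : ∀ S, subProd a S ≠ z) :
    sgnCount a z = 0 :=
  Finset.sum_eq_zero fun S _ => if_neg (h S)

/-! ### Linear independence of the geometric progressions `r ↦ zʳ` -/

/-- If `∑_{z ∈ V} w(z) zʳ = 0` for all `r ≥ 1` then `w(z) = 0` for every nonzero `z ∈ V`
(Lagrange interpolation: test against `P = X ∏_{z' ≠ z₀} (X - z')`, which has no constant term).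
[folklore] -/
theorem eq_zero_of_forall_sum_mul_pow_eq_zero (V : Finset ℂ) (w : ℂ → ℂ)
    (h : ∀ r : ℕ, 0 < r → ∑ z ∈ V, w z * z ^ r = 0) {z₀ : ℂ} (hz₀ : z₀ ∈ V) (hz₀0 : z₀ ≠ 0) :
    w z₀ = 0 := by
  classical
  set P : ℂ[X] := X * ∏ z ∈ V.erase z₀, (X - C z) with hP
  -- pairing a polynomial without constant term against `w` gives zero
  have hpair : ∀ Q : ℂ[X], ∑ z ∈ V, w z * (X * Q).eval z = 0 := by
    intro Q
    have hexp : ∀ z : ℂ, (X * Q).eval z =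
        ∑ r ∈ Finset.range ((X * Q).natDegree + 1), (X * Q).coeff r * z ^ r := fun z =>
      Polynomial.eval_eq_sum_range' (Nat.lt_succ_self _) z
    simp_rw [hexp, Finset.mul_sum]
    rw [Finset.sum_comm]
    refine Finset.sum_eq_zero fun r hr => ?_
    rcases Nat.eq_zero_or_pos r with rfl | hr0
    · simp
    · have : ∑ z ∈ V, w z * ((X * Q).coeff r * z ^ r) = (X * Q).coeff r * ∑ z ∈ V, w z * z ^ r := by
        rw [Finset.mul_sum]; exact Finset.sum_congr rfl fun z _ => by ring
      rw [this, h r hr0, mul_zero]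
  have h0 := hpair (∏ z ∈ V.erase z₀, (X - C z))
  rw [← Finset.add_sum_erase V _ hz₀] at h0
  have hrest : ∑ z ∈ V.erase z₀, w z * (X * ∏ z' ∈ V.erase z₀, (X - C z')).eval z = 0 := by
    refine Finset.sum_eq_zero fun z hz => ?_
    rw [Polynomial.eval_mul, Polynomial.eval_prod,
      Finset.prod_eq_zero hz (by simp), mul_zero, mul_zero]
  rw [hrest, add_zero, Polynomial.eval_mul, Polynomial.eval_X, Polynomial.eval_prod] at h0
  have hne : ∏ z ∈ V.erase z₀, (X - C z).eval z₀ ≠ 0 := by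
    refine Finset.prod_ne_zero_iff.2 fun z hz => ?_
    rw [Polynomial.eval_sub, Polynomial.eval_X, Polynomial.eval_C]
    exact sub_ne_zero.2 (Ne.symm (Finset.ne_of_mem_erase hz))
  have := mul_eq_zero.1 h0
  rcases this with h1 | h1
  · exact h1
  · exact absurd h1 (mul_ne_zero hz₀0 hne)

/-! ### Equality of the signed counts -/

variable {κ : Type*} [Fintype κ]

/-- **The signed counts agree.** If all `aᵢ, b_j` are nonzero and `∏ᵢ (1 - aᵢʳ) = ∏ⱼ (1 - bⱼʳ)`
for all `r ≥ 1`, then `μ_a = μ_b`. [folklore] -/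
theorem sgnCount_eq_sgnCount {a : ι → ℂ} {b : κ → ℂ} (ha : ∀ i, a i ≠ 0) (hb : ∀ j, b j ≠ 0)
    (h : ∀ r : ℕ, 0 < r → ∏ i, (1 - a i ^ r) = ∏ j, (1 - b j ^ r)) :
    sgnCount a = sgnCount b := by
  classical
  funext z
  set V : Finset ℂ := (univ.image (subProd a)) ∪ (univ.image (subProd b)) with hV
  have hVa : ∀ S, subProd a S ∈ V := fun S => Finset.mem_union_left _ (Finset.mem_image_of_mem _ (mem_univ S))
  have hVb : ∀ T, subProd b T ∈ V := fun T => Finset.mem_union_right _ (Finset.mem_image_of_mem _ (mem_univ T))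
  by_cases hz : z ∈ V
  · have hz0 : z ≠ 0 := by
      rintro rfl
      rcases Finset.mem_union.1 hz with h' | h'
      · obtain ⟨S, -, hS⟩ := Finset.mem_image.1 h'
        exact subProd_ne_zero ha S hS
      · obtain ⟨T, -, hT⟩ := Finset.mem_image.1 h'
        exact subProd_ne_zero hb T hT
    have key := eq_zero_of_forall_sum_mul_pow_eq_zero V (fun z => (sgnCount a z : ℂ) - sgnCount b z)
      (fun r hr => by
        simp only [sub_mul, Finset.sum_sub_distrib, sum_sgnCount_mul_pow a hVa,
          sum_sgnCount_mul_pow b hVb, ← prod_one_sub_pow_eq_sum, h r hr, sub_self]) hz hz0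
    exact_mod_cast sub_eq_zero.1 key
  · rw [sgnCount_eq_zero_of_forall_ne fun S hS => hz (by rw [← hS]; exact hVa S),
      sgnCount_eq_zero_of_forall_ne fun T hT => hz (by rw [← hT]; exact hVb T)]

/-! ### Norm bookkeeping -/

omit [Fintype ι] in
/-- A product of reals `≥ 1` is `≥ 1`. [folklore] -/
theorem one_le_prod_norm {a : ι → ℂ} {S : Finset ι} (h : ∀ i ∈ S, 1 ≤ ‖a i‖) :
    1 ≤ ∏ i ∈ S, ‖a i‖ := by
  induction S using Finset.induction_on with
  | empty => simp
  | insert i S hi ih =>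
    rw [Finset.prod_insert hi]
    have h1 := h i (Finset.mem_insert_self i S)
    have h2 := ih fun j hj => h j (Finset.mem_insert_of_mem hj)
    nlinarith

omit [Fintype ι] in
/-- A nonempty product of reals `> 1` is `> 1`. [folklore] -/
theorem one_lt_prod_norm {a : ι → ℂ} {S : Finset ι} (hS : S.Nonempty) (h : ∀ i ∈ S, 1 < ‖a i‖) :
    1 < ∏ i ∈ S, ‖a i‖ := by
  obtain ⟨i₀, hi₀⟩ := hS
  rw [← Finset.mul_prod_erase S _ hi₀]
  have h1 := h i₀ hi₀
  have h2 : 1 ≤ ∏ i ∈ S.erase i₀, ‖a i‖ :=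
    one_le_prod_norm fun j hj => (h j (Finset.mem_of_mem_erase hj)).le
  nlinarith

omit [Fintype ι] in
/-- A nonempty product of moduli `< 1` is `< 1`. [folklore] -/
theorem prod_norm_lt_one {a : ι → ℂ} {S : Finset ι} (hS : S.Nonempty) (h : ∀ i ∈ S, ‖a i‖ < 1) :
    ∏ i ∈ S, ‖a i‖ < 1 := by
  obtain ⟨i₀, hi₀⟩ := hS
  rw [← Finset.mul_prod_erase S _ hi₀]
  have h1 := h i₀ hi₀
  have h0 : 0 ≤ ‖a i₀‖ := norm_nonneg _
  have h2 : ∏ i ∈ S.erase i₀, ‖a i‖ ≤ 1 :=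
    Finset.prod_le_one (fun j _ => norm_nonneg _) fun j hj => (h j (Finset.mem_of_mem_erase hj)).le
  have h3 : 0 ≤ ∏ i ∈ S.erase i₀, ‖a i‖ := Finset.prod_nonneg fun j _ => norm_nonneg _
  nlinarith

omit [Fintype ι] in
/-- `t^{|S|} ≤ ‖a_S‖` when `t ≤ ‖aᵢ‖` for all `i` (`t ≥ 0`). [folklore] -/
theorem pow_card_le_norm_subProd {a : ι → ℂ} {t : ℝ} (ht : 0 ≤ t) (hat : ∀ i, t ≤ ‖a i‖)
    (S : Finset ι) : t ^ S.card ≤ ‖subProd a S‖ := by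
  rw [norm_subProd, ← Finset.prod_const]
  exact Finset.prod_le_prod (fun _ _ => ht) fun i _ => hat i

/-! ### The pushforward of `μ_a` to moduli, and the absence of elements of modulus `1` -/

/-- `M_a(t) = ∑_{S : ‖a_S‖ = t} (-1)^{|S|}`. [folklore] -/
def normCount (a : ι → ℂ) (t : ℝ) : ℤ :=
  ∑ S : Finset ι, if ‖subProd a S‖ = t then (-1) ^ S.card else 0

/-- `M_a(t) = ∑_{‖z‖ = t} μ_a(z)`. [folklore] -/
theorem normCount_eq_sum_sgnCount (a : ι → ℂ) {W : Finset ℂ} (hW : ∀ S, subProd a S ∈ W) (t : ℝ) :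
    normCount a t = ∑ z ∈ W.filter (fun z => ‖z‖ = t), sgnCount a z := by
  unfold normCount sgnCount
  rw [Finset.sum_comm]
  refine Finset.sum_congr rfl fun S _ => ?_
  rw [Finset.sum_ite_eq]
  simp only [Finset.mem_filter, hW S, true_and]

/-- Equal signed counts have equal pushforwards. [folklore] -/
theorem normCount_eq_normCount {a : ι → ℂ} {b : κ → ℂ} (hμ : sgnCount a = sgnCount b) :
    normCount a = normCount b := by
  funext t
  set W : Finset ℂ := (univ.image (subProd a)) ∪ (univ.image (subProd b))
  have hWa : ∀ S, subProd a S ∈ W := fun S =>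
    Finset.mem_union_left _ (Finset.mem_image_of_mem _ (mem_univ S))
  have hWb : ∀ T, subProd b T ∈ W := fun T =>
    Finset.mem_union_right _ (Finset.mem_image_of_mem _ (mem_univ T))
  rw [normCount_eq_sum_sgnCount a hWa, normCount_eq_sum_sgnCount b hWb, hμ]

/-- If all `‖bⱼ‖ > 1` then `M_b(1) = 1`: only `T = ∅` has `‖b_T‖ = 1`. [folklore] -/
theorem normCount_one {b : κ → ℂ} (hb : ∀ j, 1 < ‖b j‖) : normCount b 1 = 1 := by
  unfold normCount
  rw [Finset.sum_eq_single (∅ : Finset κ)]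
  · simp
  · intro T _ hT
    rw [if_neg]
    rw [norm_subProd]
    exact (one_lt_prod_norm (Finset.nonempty_iff_ne_empty.2 hT) fun j _ => hb j).ne'
  · intro h; exact absurd (Finset.mem_univ _) h

/-- If some `aᵢ₀` has modulus `1` then `M_a ≡ 0`: the involution `S ↦ S ∆ {i₀}` preserves `‖a_S‖`
and reverses the sign `(-1)^{|S|}`. [folklore] -/
theorem normCount_eq_zero_of_norm_eq_one {a : ι → ℂ} {i₀ : ι} (hi₀ : ‖a i₀‖ = 1) (t : ℝ) :
    normCount a t = 0 := by
  unfold normCount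
  refine Finset.sum_involution (fun S _ => if i₀ ∈ S then S.erase i₀ else insert i₀ S)
    ?_ ?_ ?_ ?_
  · intro S _
    by_cases hi : i₀ ∈ S
    · simp only [hi, if_true]
      have hnorm : ‖subProd a (S.erase i₀)‖ = ‖subProd a S‖ := by
        rw [subProd, subProd, ← Finset.prod_erase_mul S a hi, norm_mul, hi₀, mul_one]
      have hcard : S.card = (S.erase i₀).card + 1 := by
        rw [Finset.card_erase_of_mem hi]; have := Finset.card_pos.2 ⟨i₀, hi⟩; omega
      rw [hnorm, hcard, pow_succ]
      split_ifs <;> ring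
    · simp only [hi, if_false]
      have hnorm : ‖subProd a (insert i₀ S)‖ = ‖subProd a S‖ := by
        rw [subProd, Finset.prod_insert hi, norm_mul, hi₀, one_mul, subProd]
      rw [hnorm, Finset.card_insert_of_notMem hi, pow_succ]
      split_ifs <;> ring
  · intro S _ _
    by_cases hi : i₀ ∈ S
    · simp only [hi, if_true]
      exact fun h => (Finset.notMem_erase i₀ S) (h.symm ▸ hi)
    · simp only [hi, if_false]
      exact fun h => hi (h ▸ Finset.mem_insert_self i₀ S)
  · intro S _; exact Finset.mem_univ _
  · intro S _
    by_cases hi : i₀ ∈ S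
    · simp [hi, Finset.insert_erase hi]
    · simp [hi, Finset.erase_insert hi]

/-! ### All `aᵢ` have modulus `> 1` -/

/-- **No small elements.** If all `bⱼ` have modulus `> 1`, all `aᵢ ≠ 0`, and
`∏ᵢ (1 - aᵢʳ) = ∏ⱼ (1 - bⱼʳ)` for all `r ≥ 1`, then all `aᵢ` have modulus `> 1`. Modulus `= 1` is
excluded by `M_a ≡ 0 ≠ 1 = M_b(1)`; modulus `< 1`: the set `S₀` of such indices would give the unique
subset product `a_{S₀}` of minimal modulus `< 1`, where `μ_a ≠ 0 = μ_b`. [folklore] -/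
theorem one_lt_norm {a : ι → ℂ} {b : κ → ℂ} (ha : ∀ i, a i ≠ 0) (hb : ∀ j, 1 < ‖b j‖)
    (h : ∀ r : ℕ, 0 < r → ∏ i, (1 - a i ^ r) = ∏ j, (1 - b j ^ r)) (i : ι) : 1 < ‖a i‖ := by
  have hb0 : ∀ j, b j ≠ 0 := fun j h0 => by have := hb j; rw [h0, norm_zero] at this; linarith
  have hμ := sgnCount_eq_sgnCount ha hb0 h
  -- no modulus-one elements
  have hne1 : ∀ i, ‖a i‖ ≠ 1 := fun i₀ h1 => by
    have := congrFun (normCount_eq_normCount hμ) 1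
    rw [normCount_eq_zero_of_norm_eq_one h1, normCount_one hb] at this
    exact zero_ne_one this
  -- no elements of modulus `< 1`
  set S₀ : Finset ι := univ.filter fun i => ‖a i‖ < 1 with hS₀
  have hmemS₀ : ∀ i, i ∈ S₀ ↔ ‖a i‖ < 1 := fun i => by simp [hS₀]
  suffices hempty : S₀ = ∅ by
    have hi : ¬ ‖a i‖ < 1 := fun hlt => by
      have : i ∈ S₀ := (hmemS₀ i).2 hlt
      rw [hempty] at this; exact absurd this (Finset.notMem_empty i)
    exact lt_of_le_of_ne (not_lt.1 hi) (Ne.symm (hne1 i))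
  by_contra hne
  have hS₀ne : S₀.Nonempty := Finset.nonempty_iff_ne_empty.2 hne
  set z₀ := subProd a S₀ with hz₀
  have hm₀ : ‖z₀‖ < 1 := by
    rw [hz₀, norm_subProd]; exact prod_norm_lt_one hS₀ne fun i hi => (hmemS₀ i).1 hi
  -- outside `S₀` the moduli are `> 1`
  have hout : ∀ i, i ∉ S₀ → 1 < ‖a i‖ := fun i hi =>
    lt_of_le_of_ne (not_lt.1 fun hlt => hi ((hmemS₀ i).2 hlt)) (Ne.symm (hne1 i))
  -- the only subset with product `z₀` is `S₀`
  have huniq : ∀ S, subProd a S = z₀ → S = S₀ := by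
    intro S hS
    have hnS : ‖subProd a S‖ = ‖z₀‖ := by rw [hS]
    rw [hz₀, norm_subProd, norm_subProd] at hnS
    -- `∏_S ≥ ∏_{S ∩ S₀} ≥ ∏_{S₀}` with strictness unless `S = S₀`
    have hsplit : ∏ i ∈ S, ‖a i‖ = (∏ i ∈ S ∩ S₀, ‖a i‖) * ∏ i ∈ S \ S₀, ‖a i‖ :=
      (Finset.prod_inter_mul_prod_sdiff S S₀ _).symm
    have hsplit' : ∏ i ∈ S₀, ‖a i‖ = (∏ i ∈ S ∩ S₀, ‖a i‖) * ∏ i ∈ S₀ \ S, ‖a i‖ := by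
      rw [← Finset.prod_inter_mul_prod_sdiff S₀ S, Finset.inter_comm]
    have hpos : 0 < ∏ i ∈ S ∩ S₀, ‖a i‖ :=
      Finset.prod_pos fun i _ => norm_pos_iff.2 (ha i)
    have hge1 : 1 ≤ ∏ i ∈ S \ S₀, ‖a i‖ :=
      one_le_prod_norm fun i hi => (hout i (Finset.mem_sdiff.1 hi).2).le
    have hle1 : ∏ i ∈ S₀ \ S, ‖a i‖ ≤ 1 :=
      Finset.prod_le_one (fun _ _ => norm_nonneg _)
        fun i hi => ((hmemS₀ i).1 (Finset.mem_sdiff.1 hi).1).le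
    by_contra hSne
    rcases Finset.eq_empty_or_nonempty (S \ S₀) with h1 | h1
    · -- `S ⊆ S₀`, strictly, so `S₀ \ S` is nonempty and its product is `< 1`
      have hsub : S ⊆ S₀ := Finset.sdiff_eq_empty_iff_subset.1 h1
      have h2 : (S₀ \ S).Nonempty := by
        rw [Finset.sdiff_nonempty]; exact fun h' => hSne (Finset.Subset.antisymm hsub h')
      have hlt1 : ∏ i ∈ S₀ \ S, ‖a i‖ < 1 :=
        prod_norm_lt_one h2 fun i hi => (hmemS₀ i).1 (Finset.mem_sdiff.1 hi).1
      rw [hsplit, hsplit', h1, Finset.prod_empty, mul_one] at hnS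
      nlinarith
    · have hgt1 : 1 < ∏ i ∈ S \ S₀, ‖a i‖ :=
        one_lt_prod_norm h1 fun i hi => hout i (Finset.mem_sdiff.1 hi).2
      rw [hsplit, hsplit'] at hnS
      nlinarith
  have hμa : sgnCount a z₀ = (-1) ^ S₀.card := by
    unfold sgnCount
    rw [Finset.sum_eq_single S₀]
    · simp [hz₀]
    · intro S _ hS; rw [if_neg fun h' => hS (huniq S h')]
    · intro h'; exact absurd (Finset.mem_univ _) h'
  have hμb : sgnCount b z₀ = 0 := by
    refine sgnCount_eq_zero_of_forall_ne fun T hT => ?_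
    have : 1 ≤ ‖subProd b T‖ := by rw [norm_subProd]; exact one_le_prod_norm fun j _ => (hb j).le
    rw [hT] at this; linarith
  have := congrFun hμ z₀
  rw [hμa, hμb] at this
  exact (pow_ne_zero _ (by norm_num : (-1 : ℤ) ≠ 0)) this

/-! ### On the circle of least modulus, `μ_a = -#` -/

/-- If `t > 1` and all `‖aᵢ‖ ≥ t`, then on the circle `‖z‖ = t` only singletons contribute to
`μ_a(z)`, so `μ_a(z) = -#{i : aᵢ = z}`. [folklore] -/
theorem sgnCount_eq_neg_cnt {a : ι → ℂ} {t : ℝ} (ht : 1 < t) (hat : ∀ i, t ≤ ‖a i‖) {z : ℂ}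
    (hz : ‖z‖ = t) : sgnCount a z = -(cnt a z : ℤ) := by
  -- a subset with product `z` is a singleton
  have hsing : ∀ S : Finset ι, subProd a S = z → ∃ i, a i = z ∧ S = {i} := by
    intro S hS
    have hcard : S.card = 1 := by
      by_contra hc
      rcases Nat.lt_or_gt_of_ne hc with h0 | h2
      · have : S = ∅ := Finset.card_eq_zero.1 (by omega)
        rw [this, subProd_empty] at hS
        rw [← hS, norm_one] at hz
        exact absurd hz ht.ne
      · have hle := pow_card_le_norm_subProd (zero_le_one.trans ht.le) hat S
        rw [hS, hz] at hle
        have hlt : t < t ^ S.card := lt_self_pow₀ ht (by omega)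
        linarith
    obtain ⟨i, rfl⟩ := Finset.card_eq_one.1 hcard
    exact ⟨i, by rwa [subProd_singleton] at hS, rfl⟩
  have hfilt : (univ.filter fun S : Finset ι => subProd a S = z) =
      (univ.filter fun i => a i = z).map ⟨fun i => ({i} : Finset ι), Finset.singleton_injective⟩ := by
    ext S
    simp only [Finset.mem_filter, Finset.mem_univ, true_and, Finset.mem_map,
      Function.Embedding.coeFn_mk]
    constructor
    · intro hS
      obtain ⟨i, hi, rfl⟩ := hsing S hS
      exact ⟨i, hi, rfl⟩
    · rintro ⟨i, hi, rfl⟩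
      rw [subProd_singleton, hi]
  unfold sgnCount cnt
  rw [← Finset.sum_filter, hfilt, Finset.sum_map]
  simp

/-- **If `a` is nonempty then so is `b`** (all `aᵢ ≠ 0`, all `‖bⱼ‖ = c > 1`, equal products): at an
element `aᵢ₀` of least modulus `μ_a < 0`, so some nonempty `T` has `b_T = aᵢ₀`. [folklore] -/
theorem nonempty_of_nonempty {a : ι → ℂ} {b : κ → ℂ} (ha : ∀ i, a i ≠ 0) {c : ℝ} (hc : 1 < c)
    (hbc : ∀ j, ‖b j‖ = c) (h : ∀ r : ℕ, 0 < r → ∏ i, (1 - a i ^ r) = ∏ j, (1 - b j ^ r))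
    [Nonempty ι] : Nonempty κ := by
  have hb : ∀ j, 1 < ‖b j‖ := fun j => (hbc j).symm ▸ hc
  have hb0 : ∀ j, b j ≠ 0 := fun j h0 => by have := hb j; rw [h0, norm_zero] at this; linarith
  have hμ := sgnCount_eq_sgnCount ha hb0 h
  have ha1 := one_lt_norm ha hb h
  set ρ : ℝ := (univ.image fun i => ‖a i‖).min' (Finset.univ_nonempty.image _) with hρ
  obtain ⟨i₀, -, hi₀⟩ : ∃ i₀ ∈ (univ : Finset ι), ‖a i₀‖ = ρ :=
    Finset.mem_image.1 (Finset.min'_mem _ _)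
  have hρle : ∀ i, ρ ≤ ‖a i‖ := fun i => Finset.min'_le _ _ (Finset.mem_image_of_mem _ (mem_univ i))
  have hρ1 : 1 < ρ := hi₀ ▸ ha1 i₀
  have hμa : sgnCount a (a i₀) = -(cnt a (a i₀) : ℤ) := sgnCount_eq_neg_cnt hρ1 hρle hi₀
  have hcnt : 0 < cnt a (a i₀) := Finset.card_pos.2 ⟨i₀, by simp⟩
  have hμb : sgnCount b (a i₀) ≠ 0 := by rw [← hμ, hμa]; omega
  obtain ⟨T, hT⟩ : ∃ T, subProd b T = a i₀ := by
    by_contra h'; push Not at h'; exact hμb (sgnCount_eq_zero_of_forall_ne h')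
  have hTne : T.Nonempty := by
    rw [Finset.nonempty_iff_ne_empty]; rintro rfl
    rw [subProd_empty] at hT; rw [← hT, norm_one] at hi₀; linarith
  obtain ⟨j, -⟩ := hTne
  exact ⟨j⟩

/-- **On the circle `‖z‖ = c` the counts agree**: `#{i : aᵢ = z} = #{j : bⱼ = z}` (all `aᵢ ≠ 0`,
all `‖bⱼ‖ = c > 1`, equal products `∏ (1 - aᵢʳ) = ∏ (1 - bⱼʳ)`). The least modulus `ρ` of the
`aᵢ` is `c` (compare `μ_a` and `μ_b` at an `aᵢ` of modulus `ρ` and at a `bⱼ`), and on that circle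
`μ_a = -#_a`, `μ_b = -#_b`. [folklore] -/
theorem cnt_eq_cnt_of_norm_eq {a : ι → ℂ} {b : κ → ℂ} (ha : ∀ i, a i ≠ 0) {c : ℝ} (hc : 1 < c)
    (hbc : ∀ j, ‖b j‖ = c) (h : ∀ r : ℕ, 0 < r → ∏ i, (1 - a i ^ r) = ∏ j, (1 - b j ^ r))
    {z : ℂ} (hz : ‖z‖ = c) : cnt a z = cnt b z := by
  have hb : ∀ j, 1 < ‖b j‖ := fun j => (hbc j).symm ▸ hc
  have hb0 : ∀ j, b j ≠ 0 := fun j h0 => by have := hb j; rw [h0, norm_zero] at this; linarith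
  have hμ := sgnCount_eq_sgnCount ha hb0 h
  have hμb : sgnCount b z = -(cnt b z : ℤ) := sgnCount_eq_neg_cnt hc (fun j => (hbc j).ge) hz
  rcases isEmpty_or_nonempty ι with hι | hι
  · -- `a` empty: `μ_a(z) = 0` (`z ≠ 1`), hence `#_b(z) = 0`
    have hca : cnt a z = 0 := by simp [cnt]
    have hμa : sgnCount a z = 0 := by
      refine sgnCount_eq_zero_of_forall_ne fun S hS => ?_
      rw [Finset.eq_empty_of_isEmpty S, subProd_empty] at hS
      rw [← hS, norm_one] at hz; exact absurd hz hc.ne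
    rw [hca]; have := congrFun hμ z; rw [hμa, hμb] at this; omega
  · have ha1 := one_lt_norm ha hb h
    set ρ : ℝ := (univ.image fun i => ‖a i‖).min' (Finset.univ_nonempty.image _) with hρ
    obtain ⟨i₀, -, hi₀⟩ : ∃ i₀ ∈ (univ : Finset ι), ‖a i₀‖ = ρ :=
      Finset.mem_image.1 (Finset.min'_mem _ _)
    have hρle : ∀ i, ρ ≤ ‖a i‖ := fun i => Finset.min'_le _ _ (Finset.mem_image_of_mem _ (mem_univ i))
    have hρ1 : 1 < ρ := hi₀ ▸ ha1 i₀
    -- `ρ ≥ c`: at `a i₀`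
    have hμa₀ : sgnCount a (a i₀) = -(cnt a (a i₀) : ℤ) := sgnCount_eq_neg_cnt hρ1 hρle hi₀
    have hcnt₀ : 0 < cnt a (a i₀) := Finset.card_pos.2 ⟨i₀, by simp⟩
    obtain ⟨T, hT⟩ : ∃ T, subProd b T = a i₀ := by
      by_contra h'; push Not at h'
      have := sgnCount_eq_zero_of_forall_ne h'
      rw [← hμ, hμa₀] at this; omega
    have hTne : T.Nonempty := by
      rw [Finset.nonempty_iff_ne_empty]; rintro rfl
      rw [subProd_empty] at hT; rw [← hT, norm_one] at hi₀; linarith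
    have hge : c ≤ ρ := by
      have h1 : ‖subProd b T‖ = c ^ T.card := by
        rw [norm_subProd, Finset.prod_congr rfl fun j _ => hbc j, Finset.prod_const]
      rw [hT, hi₀] at h1
      rw [h1]
      exact le_self_pow₀ hc.le (Finset.card_pos.2 hTne).ne'
    -- `ρ ≤ c`: at some `b j₁`
    obtain ⟨j₁, -⟩ := hTne
    have hμb₁ : sgnCount b (b j₁) = -(cnt b (b j₁) : ℤ) :=
      sgnCount_eq_neg_cnt hc (fun j => (hbc j).ge) (hbc j₁)
    have hcnt₁ : 0 < cnt b (b j₁) := Finset.card_pos.2 ⟨j₁, by simp⟩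
    obtain ⟨S, hS⟩ : ∃ S, subProd a S = b j₁ := by
      by_contra h'; push Not at h'
      have := sgnCount_eq_zero_of_forall_ne h'
      rw [hμ, hμb₁] at this; omega
    have hSne : S.Nonempty := by
      rw [Finset.nonempty_iff_ne_empty]; rintro rfl
      rw [subProd_empty] at hS
      have := hbc j₁; rw [← hS, norm_one] at this; exact absurd this hc.ne
    have hle : ρ ≤ c := by
      have h1 := pow_card_le_norm_subProd (zero_le_one.trans hρ1.le) hρle S
      rw [hS, hbc j₁] at h1
      exact (le_self_pow₀ hρ1.le (Finset.card_pos.2 hSne).ne').trans h1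
    have hρc : ρ = c := le_antisymm hle hge
    -- on the circle both signed counts are minus the plain counts
    have hμa : sgnCount a z = -(cnt a z : ℤ) := sgnCount_eq_neg_cnt hc (fun i => hρc ▸ hρle i) hz
    have := congrFun hμ z
    rw [hμa, hμb] at this; omega

/-! ### The multiset is determined -/

/-- **Main lemma (counting form).** Let `aᵢ` (`i ∈ ι`) be nonzero complex numbers and `bⱼ`
(`j ∈ κ`) complex numbers all of the same modulus `c > 1`. If `∏ᵢ (1 - aᵢʳ) = ∏ⱼ (1 - bⱼʳ)` for
every `r ≥ 1`, then `#{i : aᵢ = z} = #{j : bⱼ = z}` for every `z`; in particular the two families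
have the same number of elements and the same multiset of values. This is the elementary device by
which the identity `#J(𝔽_{q^r}) = det(1 - πʳ | T_ℓ J) = h(F𝔽_{q^r}) = ∏ᵢ (1 - αᵢʳ)` for all `r`
identifies the eigenvalues of Frobenius on the Tate module with the reciprocal roots `αᵢ` of the
`L`-polynomial (Weil; cf. Milne, *Abelian varieties*, Thm. 19.1 and Cor. 19.4, and the `ℓ`-adic
variant in Lang, *Abelian Varieties*, VII §1, Lemma preceding Thm. 3). Proof: on the circle
`‖z‖ = c` by `cnt_eq_cnt_of_norm_eq`; off it, the `aᵢ` of modulus `≠ c` form a family with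
`∏ (1 - aᵢʳ) = 1` for all `r` (cancel the common, nonvanishing, circle part), which must be empty
(`nonempty_of_nonempty` against the empty family). [folklore] -/
theorem cnt_eq_cnt {a : ι → ℂ} {b : κ → ℂ} (ha : ∀ i, a i ≠ 0) {c : ℝ} (hc : 1 < c)
    (hbc : ∀ j, ‖b j‖ = c) (h : ∀ r : ℕ, 0 < r → ∏ i, (1 - a i ^ r) = ∏ j, (1 - b j ^ r))
    (z : ℂ) : cnt a z = cnt b z := by
  by_cases hz : ‖z‖ = c
  · exact cnt_eq_cnt_of_norm_eq ha hc hbc h hz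
  -- it remains to see that every `aᵢ` has modulus `c`
  suffices hall : ∀ i, ‖a i‖ = c by
    have h1 : cnt a z = 0 := Finset.card_eq_zero.2 (Finset.filter_eq_empty_iff.2
      fun i _ hi => hz (hi ▸ hall i))
    have h2 : cnt b z = 0 := Finset.card_eq_zero.2 (Finset.filter_eq_empty_iff.2
      fun j _ hj => hz (hj ▸ hbc j))
    rw [h1, h2]
  -- the circle part of `∏ (1 - aᵢʳ)` equals `∏ (1 - bⱼʳ)`
  have hb : ∀ j, 1 < ‖b j‖ := fun j => (hbc j).symm ▸ hc
  set A := univ.filter (fun i : ι => ‖a i‖ = c) with hA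
  have hmemA : ∀ i, i ∈ A ↔ ‖a i‖ = c := fun i => by simp [hA]
  have hexp : ∀ w, ‖w‖ = c → (A.filter fun i => a i = w).card = cnt a w := by
    intro w hw
    unfold cnt
    congr 1
    ext i
    simp only [Finset.mem_filter, mem_univ, true_and, hmemA]
    exact ⟨fun h' => h'.2, fun h' => ⟨by rw [h']; exact hw, h'⟩⟩
  have hcnt0 : ∀ w, ‖w‖ = c → w ∉ A.image a → cnt b w = 0 := by
    intro w hw hwA
    rw [← cnt_eq_cnt_of_norm_eq ha hc hbc h hw]
    refine Finset.card_eq_zero.2 (Finset.filter_eq_empty_iff.2 fun i _ hi => hwA ?_)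
    exact Finset.mem_image.2 ⟨i, (hmemA i).2 (by rw [hi]; exact hw), hi⟩
  have hcirc : ∀ r : ℕ, 0 < r → ∏ i ∈ A, (1 - a i ^ r) = ∏ j, (1 - b j ^ r) := by
    intro r _
    set Z : Finset ℂ := A.image a ∪ univ.image b with hZ
    have hZn : ∀ w ∈ Z, ‖w‖ = c := by
      intro w hw
      rcases Finset.mem_union.1 hw with hw | hw
      · obtain ⟨i, hi, rfl⟩ := Finset.mem_image.1 hw; exact (hmemA i).1 hi
      · obtain ⟨j, -, rfl⟩ := Finset.mem_image.1 hw; exact hbc j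
    calc ∏ i ∈ A, (1 - a i ^ r)
        = ∏ w ∈ A.image a, (1 - w ^ r) ^ (A.filter fun i => a i = w).card :=
          Finset.prod_comp (fun w : ℂ => 1 - w ^ r) a
      _ = ∏ w ∈ A.image a, (1 - w ^ r) ^ cnt b w := by
          refine Finset.prod_congr rfl fun w hw => ?_
          have hwn : ‖w‖ = c := hZn w (Finset.mem_union_left _ hw)
          rw [hexp w hwn, cnt_eq_cnt_of_norm_eq ha hc hbc h hwn]
      _ = ∏ w ∈ Z, (1 - w ^ r) ^ cnt b w :=
          Finset.prod_subset Finset.subset_union_left fun w hwZ hwA => by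
            rw [hcnt0 w (hZn w hwZ) hwA, pow_zero]
      _ = ∏ w ∈ univ.image b, (1 - w ^ r) ^ cnt b w := by
          refine (Finset.prod_subset Finset.subset_union_right fun w _ hwb => ?_).symm
          have : cnt b w = 0 := Finset.card_eq_zero.2 (Finset.filter_eq_empty_iff.2
            fun j _ hj => hwb (Finset.mem_image.2 ⟨j, mem_univ j, hj⟩))
          rw [this, pow_zero]
      _ = ∏ j, (1 - b j ^ r) := (Finset.prod_comp (fun w : ℂ => 1 - w ^ r) b).symm
  -- cancel the circle part: the remaining `aᵢ` have `∏ (1 - aᵢʳ) = 1`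
  have hrest : ∀ r : ℕ, 0 < r → ∏ i ∈ univ.filter (fun i => ¬ ‖a i‖ = c), (1 - a i ^ r) = 1 := by
    intro r hr
    have hsplit := Finset.prod_filter_mul_prod_filter_not (univ : Finset ι) (fun i => ‖a i‖ = c)
      (fun i => 1 - a i ^ r)
    rw [h r hr, ← hcirc r hr] at hsplit
    have hne : ∏ i ∈ A, (1 - a i ^ r) ≠ 0 := by
      rw [hcirc r hr]
      refine Finset.prod_ne_zero_iff.2 fun j _ h0 => ?_
      have h1 : ‖b j ^ r‖ = 1 := by rw [← sub_eq_zero.1 h0, norm_one]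
      rw [norm_pow, hbc j] at h1
      exact (one_lt_pow₀ hc hr.ne').ne' h1
    exact (mul_eq_left₀ hne).1 hsplit
  -- so there are none of them
  by_contra hall
  push Not at hall
  obtain ⟨i₁, hi₁⟩ := hall
  let a' : {i // ¬ ‖a i‖ = c} → ℂ := fun i => a i
  let b' : Fin 0 → ℂ := fun j => j.elim0
  haveI : Nonempty {i // ¬ ‖a i‖ = c} := ⟨⟨i₁, hi₁⟩⟩
  have h' : ∀ r : ℕ, 0 < r → ∏ i, (1 - a' i ^ r) = ∏ j, (1 - b' j ^ r) := by
    intro r hr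
    calc ∏ i, (1 - a' i ^ r) = ∏ i ∈ univ.filter (fun i => ¬ ‖a i‖ = c), (1 - a i ^ r) :=
          (Finset.prod_subtype (p := fun i => ¬ ‖a i‖ = c) (univ.filter fun i => ¬ ‖a i‖ = c)
            (fun i => by simp) (fun i => 1 - a i ^ r)).symm
      _ = 1 := hrest r hr
      _ = ∏ j, (1 - b' j ^ r) := (Fin.prod_univ_zero _).symm
  have hκ : Nonempty (Fin 0) :=
    nonempty_of_nonempty (a := a') (b := b') (fun i => ha i) hc (fun j => j.elim0) h'
  exact (not_nonempty_iff.2 inferInstance) hκ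

/-- **Main lemma (multiset form)**: under the hypotheses of `cnt_eq_cnt` the families `a` and `b`
have the same multiset of values (so in particular `|ι| = |κ|`). [folklore] -/
theorem univ_val_map_eq {a : ι → ℂ} {b : κ → ℂ} (ha : ∀ i, a i ≠ 0) {c : ℝ} (hc : 1 < c)
    (hbc : ∀ j, ‖b j‖ = c) (h : ∀ r : ℕ, 0 < r → ∏ i, (1 - a i ^ r) = ∏ j, (1 - b j ^ r)) :
    (univ : Finset ι).val.map a = (univ : Finset κ).val.map b := by
  refine Multiset.ext.2 fun z => ?_
  rw [Multiset.count_map, Multiset.count_map]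
  have hza := cnt_eq_cnt ha hc hbc h z
  unfold cnt at hza
  rw [Finset.card_def, Finset.card_def, Finset.filter_val, Finset.filter_val] at hza
  convert hza using 2 <;> exact Multiset.filter_congr fun x _ => eq_comm

/-- **Main lemma (cardinality form)**: `|ι| = |κ|`. [folklore] -/
theorem card_eq_card {a : ι → ℂ} {b : κ → ℂ} (ha : ∀ i, a i ≠ 0) {c : ℝ} (hc : 1 < c)
    (hbc : ∀ j, ‖b j‖ = c) (h : ∀ r : ℕ, 0 < r → ∏ i, (1 - a i ^ r) = ∏ j, (1 - b j ^ r)) :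
    Fintype.card ι = Fintype.card κ := by
  have := congrArg Multiset.card (univ_val_map_eq ha hc hbc h)
  simpa using this

/-- **Main lemma (polynomial form)**: `∏ᵢ (1 - aᵢ t) = ∏ⱼ (1 - bⱼ t)` in `ℂ[t]`. [folklore] -/
theorem prod_one_sub_C_mul_X_eq {a : ι → ℂ} {b : κ → ℂ} (ha : ∀ i, a i ≠ 0) {c : ℝ} (hc : 1 < c)
    (hbc : ∀ j, ‖b j‖ = c) (h : ∀ r : ℕ, 0 < r → ∏ i, (1 - a i ^ r) = ∏ j, (1 - b j ^ r)) :
    ∏ i, (1 - C (a i) * X) = ∏ j, (1 - C (b j) * X) := by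
  have key := univ_val_map_eq ha hc hbc h
  rw [Finset.prod_eq_multiset_prod, Finset.prod_eq_multiset_prod,
    show (univ : Finset ι).val.map (fun i => 1 - C (a i) * X) =
      ((univ : Finset ι).val.map a).map (fun z => 1 - C z * X) from
        (Multiset.map_map (fun z => 1 - C z * X) a _).symm,
    show (univ : Finset κ).val.map (fun j => 1 - C (b j) * X) =
      ((univ : Finset κ).val.map b).map (fun z => 1 - C z * X) from
        (Multiset.map_map (fun z => 1 - C z * X) b _).symm,
    key]

/-- **Main lemma (moduli)**: every `aᵢ` has modulus `c`. [folklore] -/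
theorem norm_eq {a : ι → ℂ} {b : κ → ℂ} (ha : ∀ i, a i ≠ 0) {c : ℝ} (hc : 1 < c)
    (hbc : ∀ j, ‖b j‖ = c) (h : ∀ r : ℕ, 0 < r → ∏ i, (1 - a i ^ r) = ∏ j, (1 - b j ^ r))
    (i : ι) : ‖a i‖ = c := by
  have hza := cnt_eq_cnt ha hc hbc h (a i)
  have hpos : 0 < cnt a (a i) := Finset.card_pos.2 ⟨i, by simp⟩
  rw [hza] at hpos
  obtain ⟨j, hj⟩ := Finset.card_pos.1 hpos
  rw [← (Finset.mem_filter.1 hj).2]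
  exact hbc j

end FrobeniusMultiset



end Literature.NumberTheory.LFunctions

end
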